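import Literature.Barriers.AtomisticToContinuum.MostHomogeneousGroundStates
import Mathlib.Data.Finset.Sort
import Mathlib.Data.Int.Interval
import Mathlib.Data.Int.LeastGreatest

/-!
# Proof of Hubbard's theorem: most homogeneous configurations are canonical ground states

This file DISCHARGES the named fact
`Literature.Barriers.AtomisticToContinuum.HubbardChain.Hubbard1978_mostHomogeneous` of
`Literature/Barriers/AtomisticToContinuum/MostHomogeneousGroundStates.lean` (statement unchanged,
imported from there): for every interaction `V` of Hubbard's class `V₁` (summable, positive and
strictly convex from distance `1` on) and every most homogeneous configuration (bi-infinite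
strictly increasing enumeration `x : ℤ → ℤ` whose `n`-th neighbour separations take only the
values `d_n`, `d_n + 1`), the configuration `configOf x` is a ground-state configuration in the
canonical ensemble: `relHamiltonian V Λ Y (configOf x) ≥ 0` for every particle-conserving local
excitation `Y` off a finite `Λ`. This is Theorem 0 of Jędrzejewski–Miękisz (direction "most
homogeneous ⇒ ground state"), due to Hubbard (1978) and Pokrovsky–Uimin (1978).

## The proof (Hubbard's argument)

Jędrzejewski–Miękisz, §3 (p. 8): "Whether we follow the argument of Hubbard [hubb78] (based on a
version of our Lemma A1) or the argument of Pokrovsky and Uimin … that proves Theorem 0 …";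
Appendix (p. 18), Definition 1 (convexity on the integers, `f(n+1) + f(n-1) ≥ 2 f(n)`) and
Lemma A1 (`f(x) + f(y) ≥ f(s) + f(t)` for `x ≤ s < t ≤ y`, `x + y ≤ s + t`). We formalise the
argument as follows.

1. `exists_enumeration` — a particle-conserving local excitation `Y` of `configOf x` is the
   configuration of a strictly increasing enumeration `y : ℤ → ℤ` that coincides with `x` outside
   a finite index window `[a, b]`, namely the indices whose particles lie in a site window
   `[m, M] ⊇ Λ` (the particles of `Y` in `[m, M]` are re-enumerated increasingly with
   `Finset.orderEmbOfFin`; the particle count makes the indices match).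
2. `hasSum_pairs`, `summable_window` — the pair energies of a configuration over the ordered
   pairs of sites meeting `[m, M]` form an absolutely convergent family, re-indexed by neighbour
   order: `∑_{n ≥ 1} ∑_{[i, i+n] ∩ [a, b] ≠ ∅} V(z(i+n) - z(i))`. Hence the relative
   Hamiltonian (whose summand vanishes off the pairs meeting `[m, M]`) is the sum over `n ≥ 1`
   of the FINITE sums `F(n) = ∑_{i = a-n}^{b} (V(y(i+n) - y(i)) - V(x(i+n) - x(i)))`
   (`HasSum.prod_fiberwise`).
3. `sum_le_sum_of_convex` (Hubbard's lemma, the supporting line of a convex `V` at `d`,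
   `supportingLine_le`) — for each `n` the `y`-gaps and the `x`-gaps over `i ∈ [a-n, b]` have the
   same total (`sum_gaps_eq`, since `y = x` off `[a, b]`), the `x`-gaps take only the values
   `d_n`, `d_n + 1`, and all gaps are `≥ 1`; convexity of `V` on the integers `≥ 1` then gives
   `F(n) ≥ 0`, whence `relHamiltonian ≥ 0` (`HasSum.nonneg`).

Only convexity (not strict convexity) and positivity of `V` on the positive integers are used;
summability of `V` makes all the families absolutely convergent.

## Sources

* J. Jędrzejewski, J. Miękisz, *Ground states of lattice gases with "almost" convex repulsive
  interactions*, J. Stat. Phys. 98 (2000) 589–620, arXiv:cond-mat/9903163: §2 Theorem 0 (p. 6),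
  §3 (p. 8), Appendix Definition 1 and Lemma A1 (p. 18). [JedrzejewskiMiekisz2000]
* J. Hubbard, *Generalized Wigner lattices in one dimension and some applications to TCNQ
  salts*, Phys. Rev. B 17 (1978) 494 (the original argument; cited through the above).
-/

noncomputable section

open scoped BigOperators

namespace Literature.Barriers.AtomisticToContinuum.HubbardChain

/-- Convexity on the integers `≥ 1` makes the increments `V(k+1) - V(k)` nondecreasing in
`k ≥ 1`. [cite: JedrzejewskiMiekisz2000, Appendix Definition 1] -/
theorem convex_incr_mono {V : ℕ → ℝ} (hconv : ∀ n, 2 ≤ n → 2 * V n ≤ V (n + 1) + V (n - 1))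
    {j k : ℕ} (hj : 1 ≤ j) (hjk : j ≤ k) : V (j + 1) - V j ≤ V (k + 1) - V k := by
  refine Nat.le_induction le_rfl (fun k hk ih => ?_) k hjk
  have h := hconv (k + 1) (by omega)
  rw [Nat.add_sub_cancel] at h
  linarith

/-- The supporting line of a convex `V` at `d ≥ 1` through `(d, V d)` and `(d+1, V (d+1))` lies
below `V` on all integers `k ≥ 1`. [cite: JedrzejewskiMiekisz2000, Appendix Lemma A1] -/
theorem supportingLine_le {V : ℕ → ℝ} (hconv : ∀ n, 2 ≤ n → 2 * V n ≤ V (n + 1) + V (n - 1))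
    {d k : ℕ} (hd : 1 ≤ d) (hk : 1 ≤ k) :
    V d + ((k : ℝ) - d) * (V (d + 1) - V d) ≤ V k := by
  rcases le_total d k with hdk | hkd
  · obtain ⟨t, rfl⟩ := Nat.exists_eq_add_of_le hdk
    have key : ∀ t : ℕ, V d + (t : ℝ) * (V (d + 1) - V d) ≤ V (d + t) := by
      intro t
      induction t with
      | zero => simp
      | succ t ih =>
        have hm := convex_incr_mono hconv hd (Nat.le_add_right d t)
        rw [← add_assoc]
        push_cast
        linarith
    have := key t
    push_cast
    linarith
  · obtain ⟨t, rfl⟩ := Nat.exists_eq_add_of_le hkd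
    have key : ∀ t k : ℕ, 1 ≤ k → V (k + t) - V k ≤ (t : ℝ) * (V (k + t + 1) - V (k + t)) := by
      intro t
      induction t with
      | zero => intro k _; simp
      | succ t ih =>
        intro k hk
        have h1 := ih (k + 1) (by omega)
        have h2 := convex_incr_mono hconv hk (show k ≤ k + t + 1 by omega)
        rw [show k + 1 + t = k + t + 1 by ring] at h1
        rw [← add_assoc]
        push_cast
        linarith
    have := key t k hk
    push_cast
    linarith

/-- **Hubbard's lemma.** For `V` convex on the integers `≥ 1`, among finite families of positive
integers with a prescribed sum, a family taking only the two values `d`, `d + 1` minimises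
`∑ V`. [cite: JedrzejewskiMiekisz2000, §3 (p. 8) and Appendix Lemma A1] -/
theorem sum_le_sum_of_convex {ι : Type*} (s : Finset ι) {V : ℕ → ℝ}
    (hconv : ∀ n, 2 ≤ n → 2 * V n ≤ V (n + 1) + V (n - 1)) {d : ℕ} (hd : 1 ≤ d) {g h : ι → ℕ}
    (hg : ∀ i ∈ s, g i = d ∨ g i = d + 1) (hh : ∀ i ∈ s, 1 ≤ h i)
    (hsum : ∑ i ∈ s, (h i : ℤ) = ∑ i ∈ s, (g i : ℤ)) :
    ∑ i ∈ s, V (g i) ≤ ∑ i ∈ s, V (h i) := by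
  have hR : ∑ i ∈ s, ((h i : ℝ)) = ∑ i ∈ s, ((g i : ℝ)) := by exact_mod_cast congrArg (Int.cast (R := ℝ)) hsum
  calc ∑ i ∈ s, V (g i) = ∑ i ∈ s, (V d + ((g i : ℝ) - d) * (V (d + 1) - V d)) := by
        refine Finset.sum_congr rfl fun i hi => ?_
        rcases hg i hi with h | h <;> rw [h] <;> push_cast <;> ring
    _ = ∑ i ∈ s, (V d + ((h i : ℝ) - d) * (V (d + 1) - V d)) := by
        rw [Finset.sum_add_distrib, Finset.sum_add_distrib, ← Finset.sum_mul, ← Finset.sum_mul,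
          Finset.sum_sub_distrib, Finset.sum_sub_distrib, hR]
    _ ≤ ∑ i ∈ s, V (h i) := Finset.sum_le_sum fun i hi => supportingLine_le hconv hd (hh i hi)

/-- The `n`-th neighbour gaps of two enumerations that agree outside the index window `[a, b]`
have the same sum over the indices `i ∈ [a - n, b]`. [folklore] -/
theorem sum_gaps_eq {x y : ℤ → ℤ} {a b : ℤ} (hxy : ∀ i, i < a ∨ b < i → y i = x i) (n : ℕ) :
    ∑ i ∈ Finset.Icc (a - n) b, (y (i + n) - y i) =
      ∑ i ∈ Finset.Icc (a - n) b, (x (i + n) - x i) := by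
  have hδ : ∀ i, i < a ∨ b < i → y i - x i = 0 := fun i hi => by rw [hxy i hi, sub_self]
  rw [← sub_eq_zero, ← Finset.sum_sub_distrib]
  have e : ∀ i, (y (i + n) - y i) - (x (i + n) - x i) = (y (i + n) - x (i + n)) - (y i - x i) :=
    fun i => by ring
  simp_rw [e]
  have h1 : ∑ i ∈ Finset.Icc (a - n) b, (y (i + n) - x (i + n)) =
      ∑ i ∈ Finset.Icc a b, (y i - x i) := by
    rw [← Finset.sum_image (g := fun i : ℤ => i + (n : ℤ)) (f := fun j => y j - x j)
      (fun i _ j _ h => by simpa using h), Finset.image_add_right_Icc, sub_add_cancel]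
    symm
    refine Finset.sum_subset (Finset.Icc_subset_Icc le_rfl (by omega)) fun i hi hni => hδ i ?_
    simp only [Finset.mem_Icc, not_and_or, not_le] at hi hni
    omega
  have h2 : ∑ i ∈ Finset.Icc (a - n) b, (y i - x i) = ∑ i ∈ Finset.Icc a b, (y i - x i) := by
    symm
    refine Finset.sum_subset (Finset.Icc_subset_Icc (by omega) le_rfl) fun i hi hni => hδ i ?_
    simp only [Finset.mem_Icc, not_and_or, not_le] at hi hni
    omega
  rw [Finset.sum_sub_distrib, h1, h2, sub_self]


/-- `configOf x` is occupied exactly on the range of `x`. [folklore] -/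
theorem configOf_eq_true_iff (x : ℤ → ℤ) (j : ℤ) : configOf x j = true ↔ j ∈ Set.range x := by
  simp only [configOf, decide_eq_true_eq]

/-- A strictly increasing `z : ℤ → ℤ` grows at least linearly: `z i + n ≤ z (i + n)`. [folklore] -/
theorem add_le_of_strictMono {z : ℤ → ℤ} (hz : StrictMono z) (i : ℤ) (n : ℕ) :
    z i + n ≤ z (i + n) := by
  induction n with
  | zero => simp
  | succ n ih =>
    have h : z (i + n) < z (i + n + 1) := hz (by omega)
    have e : i + ((n + 1 : ℕ) : ℤ) = i + n + 1 := by push_cast; ring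
    rw [e]
    push_cast
    omega

/-- A strictly increasing `z : ℤ → ℤ` grows at least linearly: `z (i - n) + n ≤ z i`. [folklore] -/
theorem le_sub_of_strictMono {z : ℤ → ℤ} (hz : StrictMono z) (i : ℤ) (n : ℕ) :
    z (i - n) + n ≤ z i := by
  have := add_le_of_strictMono hz (i - n) n
  rwa [sub_add_cancel] at this

/-- **Re-enumeration of a particle-conserving local excitation.** If `Y` agrees with the
configuration of the strictly increasing enumeration `x` off the finite set `Λ` and has the same
number of particles in `Λ`, then `Y` is the configuration of a strictly increasing enumeration `y`
which coincides with `x` outside a finite index window `[a, b]`, the window of indices whose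
particles (for `x` and for `y`) lie in an interval `[m, M] ⊇ Λ`. [folklore] -/
theorem exists_enumeration {x : ℤ → ℤ} (hx : StrictMono x) (Λ : Finset ℤ) {Y : ℤ → Bool}
    (hY : ∀ i ∉ Λ, Y i = configOf x i)
    (hcard : (Λ.filter fun i => Y i).card = (Λ.filter fun i => configOf x i).card) :
    ∃ (y : ℤ → ℤ) (a b m M : ℤ), StrictMono y ∧ (∀ j, Y j = true ↔ j ∈ Set.range y) ∧
      (∀ i, i < a ∨ b < i → y i = x i) ∧ (∀ i, m ≤ x i ∧ x i ≤ M ↔ a ≤ i ∧ i ≤ b) ∧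
      (∀ i, m ≤ y i ∧ y i ≤ M ↔ a ≤ i ∧ i ≤ b) ∧ ∀ j ∈ Λ, m ≤ j ∧ j ≤ M := by
  classical
  -- a site window `[m, M] ⊇ Λ` with `m ≤ M`
  obtain ⟨m, hm⟩ := Λ.bddBelow
  obtain ⟨M₀, hM₀⟩ := Λ.bddAbove
  set M := max M₀ m with hMdef
  have hmM : m ≤ M := le_max_right _ _
  have hΛ : ∀ j ∈ Λ, m ≤ j ∧ j ≤ M := fun j hj => ⟨hm hj, (hM₀ hj).trans (le_max_left _ _)⟩
  -- the index window `[a, b]`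
  have hgrow := add_le_of_strictMono hx
  have hgrow' := le_sub_of_strictMono hx
  obtain ⟨a, ha1, ha2⟩ := Int.exists_least_of_bdd (P := fun z => m ≤ x z)
    ⟨min 0 (m - x 0), fun z hz => by
      by_contra hlt
      have h1 := hgrow' 0 (-z).toNat
      have h2 : x z ≤ x (0 - ((-z).toNat : ℕ)) := hx.monotone (by omega)
      omega⟩
    ⟨((m - x 0).toNat : ℕ), by have := hgrow 0 (m - x 0).toNat; simp only [zero_add] at this ⊢; omega⟩
  obtain ⟨b, hb1, hb2⟩ := Int.exists_greatest_of_bdd (P := fun z => x z ≤ M)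
    ⟨max 0 (M - x 0), fun z hz => by
      by_contra hlt
      have h1 := hgrow 0 z.toNat
      have h2 : x (0 + (z.toNat : ℕ)) ≤ x z := hx.monotone (by omega)
      omega⟩
    ⟨-((x 0 - M).toNat : ℕ), by
      have := hgrow' 0 (x 0 - M).toNat; simp only [zero_sub] at this ⊢; omega⟩
  have hxlt : ∀ i, i < a → x i < m := fun i hi => by
    by_contra h; exact absurd (ha2 i (not_lt.1 h)) (by omega)
  have hxge : ∀ i, a ≤ i → m ≤ x i := fun i hi => ha1.trans (hx.monotone hi)
  have hxgt : ∀ i, b < i → M < x i := fun i hi => by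
    by_contra h; exact absurd (hb2 i (not_lt.1 h)) (by omega)
  have hxle : ∀ i, i ≤ b → x i ≤ M := fun i hi => (hx.monotone hi).trans hb1
  have hab : a ≤ b + 1 := by
    have := hb2 (a - 1) ((hxlt (a - 1) (by omega)).le.trans hmM); omega
  have hwx : ∀ i, m ≤ x i ∧ x i ≤ M ↔ a ≤ i ∧ i ≤ b := fun i =>
    ⟨fun h => ⟨not_lt.1 fun h' => absurd (hxlt i h') (not_lt.2 h.1),
      not_lt.1 fun h' => absurd (hxgt i h') (not_lt.2 h.2)⟩, fun h => ⟨hxge i h.1, hxle i h.2⟩⟩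
  have hX := configOf_eq_true_iff x
  -- the particles of `Y` in the site window and their number
  set T : Finset ℤ := (Finset.Icc m M).filter fun j => Y j with hTdef
  have hsub : Λ ⊆ Finset.Icc m M := fun j hj => Finset.mem_Icc.2 (hΛ j hj)
  have hsplit : ∀ Z : ℤ → Bool, ((Finset.Icc m M).filter fun j => Z j).card =
      (Λ.filter fun j => Z j).card + ∑ j ∈ Finset.Icc m M \ Λ, if Z j then 1 else 0 := by
    intro Z
    rw [Finset.card_filter, Finset.card_filter, ← Finset.sum_sdiff hsub, add_comm]
  have hTX : T.card = ((Finset.Icc m M).filter fun j => configOf x j).card := by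
    rw [hTdef, hsplit, hsplit, hcard]
    congr 1
    refine Finset.sum_congr rfl fun j hj => ?_
    rw [hY j (Finset.mem_sdiff.1 hj).2]
  have himage : ((Finset.Icc m M).filter fun j => configOf x j) = (Finset.Icc a b).image x := by
    ext j
    simp only [Finset.mem_filter, Finset.mem_Icc, Finset.mem_image, hX, Set.mem_range]
    constructor
    · rintro ⟨hj, i, rfl⟩
      exact ⟨i, (hwx i).1 hj, rfl⟩
    · rintro ⟨i, hi, rfl⟩
      exact ⟨(hwx i).2 hi, i, rfl⟩
  set N : ℕ := (b + 1 - a).toNat with hNdef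
  have hTN : T.card = N := by
    rw [hTX, himage, Finset.card_image_of_injective _ hx.injective, Int.card_Icc]
  -- the enumeration
  set e := T.orderEmbOfFin hTN with hedef
  have hidx : ∀ i, a ≤ i → i ≤ b → (i - a).toNat < N := fun i h1 h2 => by omega
  set y : ℤ → ℤ := fun i =>
    if i < a ∨ b < i then x i else if h : (i - a).toNat < N then e ⟨(i - a).toNat, h⟩ else 0
    with hydef
  have hy_out : ∀ i, i < a ∨ b < i → y i = x i := fun i hi => by
    simp only [hydef, if_pos hi]
  have hy_in : ∀ i (h1 : a ≤ i) (h2 : i ≤ b), y i = e ⟨(i - a).toNat, hidx i h1 h2⟩ :=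
    fun i h1 h2 => by
    have hni : ¬(i < a ∨ b < i) := by omega
    simp only [hydef, if_neg hni, dif_pos (hidx i h1 h2)]
  have hy_T : ∀ i, a ≤ i → i ≤ b → y i ∈ T := fun i h1 h2 => by
    rw [hy_in i h1 h2]; exact Finset.orderEmbOfFin_mem _ _ _
  have hT_mem : ∀ j, j ∈ T ↔ (m ≤ j ∧ j ≤ M) ∧ Y j = true := fun j => by
    rw [hTdef, Finset.mem_filter, Finset.mem_Icc]
  have hyge : ∀ i, a ≤ i → m ≤ y i := fun i hi => by
    rcases le_or_gt i b with h | h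
    · exact ((hT_mem _).1 (hy_T i hi h)).1.1
    · rw [hy_out i (Or.inr h)]; exact hxge i hi
  have hyle : ∀ i, i ≤ b → y i ≤ M := fun i hi => by
    rcases lt_or_ge i a with h | h
    · rw [hy_out i (Or.inl h)]; exact (hxlt i h).le.trans hmM
    · exact ((hT_mem _).1 (hy_T i h hi)).1.2
  have hylt : ∀ i, i < a → y i < m := fun i hi => by rw [hy_out i (Or.inl hi)]; exact hxlt i hi
  have hygt : ∀ i, b < i → M < y i := fun i hi => by rw [hy_out i (Or.inr hi)]; exact hxgt i hi
  have hwy : ∀ i, m ≤ y i ∧ y i ≤ M ↔ a ≤ i ∧ i ≤ b := fun i =>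
    ⟨fun h => ⟨not_lt.1 fun h' => absurd (hylt i h') (not_lt.2 h.1),
      not_lt.1 fun h' => absurd (hygt i h') (not_lt.2 h.2)⟩, fun h => ⟨hyge i h.1, hyle i h.2⟩⟩
  -- strict monotonicity
  have hymono : StrictMono y := by
    refine strictMono_int_of_lt_succ fun i => ?_
    rcases lt_or_ge i a with h1 | h1
    · rcases lt_or_ge (i + 1) a with h2 | h2
      · rw [hy_out i (Or.inl h1), hy_out (i + 1) (Or.inl h2)]; exact hx (by omega)
      · exact (hylt i h1).trans_le (hyge (i + 1) h2)
    · rcases lt_or_ge b (i + 1) with h2 | h2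
      · rcases lt_or_ge b i with h3 | h3
        · rw [hy_out i (Or.inr h3), hy_out (i + 1) (Or.inr h2)]; exact hx (by omega)
        · exact (hyle i h3).trans_lt (hygt (i + 1) h2)
      · rw [hy_in i h1 (by omega), hy_in (i + 1) (by omega) h2]
        exact e.strictMono (Fin.mk_lt_mk.2 (by omega))
  -- the range
  have hrange : ∀ j, Y j = true ↔ j ∈ Set.range y := by
    intro j
    constructor
    · intro hj
      by_cases hw : m ≤ j ∧ j ≤ M
      · have hjT : j ∈ (T : Set ℤ) := by exact (hT_mem j).2 ⟨hw, hj⟩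
        rw [← Finset.range_orderEmbOfFin T hTN] at hjT
        obtain ⟨k, hk⟩ := hjT
        refine ⟨a + k, ?_⟩
        have hk2 : (k : ℤ) < N := by exact_mod_cast k.2
        rw [hy_in (a + k) (by omega) (by omega), ← hk]
        congr 1
        ext
        simp
      · have hjΛ : j ∉ Λ := fun h => hw (hΛ j h)
        rw [hY j hjΛ, hX] at hj
        obtain ⟨i, rfl⟩ := hj
        have hi : i < a ∨ b < i := by
          by_contra h; exact hw ((hwx i).2 (by omega))
        exact ⟨i, hy_out i hi⟩
    · rintro ⟨i, rfl⟩
      by_cases hi : i < a ∨ b < i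
      · rw [hy_out i hi]
        have hw : ¬(m ≤ x i ∧ x i ≤ M) := fun h => by have := (hwx i).1 h; omega
        have hiΛ : x i ∉ Λ := fun h => hw (hΛ _ h)
        rw [hY _ hiΛ, hX]
        exact ⟨i, rfl⟩
      · exact ((hT_mem _).1 (hy_T i (by omega) (by omega))).2
  exact ⟨y, a, b, m, M, hymono, hrange, hy_out, hwx, hwy, hΛ⟩


/-- **Summability of the windowed `n`-th neighbour energies.** For a summable `V` (positive on
the positive integers) and a strictly increasing enumeration `z`, the family
`(n, i) ↦ V(z(i+n) - z(i))`, restricted to `n ≥ 1` and to the index pairs meeting the window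
`[a, b]`, is summable. [folklore] -/
theorem summable_window {V : ℕ → ℝ} (hVs : Summable V) {z : ℤ → ℤ} (hz : StrictMono z)
    (hVpos : ∀ n, 1 ≤ n → 0 < V n) (a b : ℤ) :
    Summable (fun q : ℕ × ℤ =>
      if 1 ≤ q.1 ∧ ((a ≤ q.2 ∧ q.2 ≤ b) ∨ (a ≤ q.2 + q.1 ∧ q.2 + q.1 ≤ b))
      then V (z (q.2 + q.1) - z q.2).natAbs else 0) := by
  have hVa : Summable fun n => |V n| := hVs.abs
  have hB1 : ∀ j : ℤ, Summable (fun q : ℕ × ℤ =>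
      if q.2 = j then |V (z (j + q.1) - z j).natAbs| else 0) := by
    intro j
    have hg : Function.Injective (fun n : ℕ => ((n, j) : ℕ × ℤ)) :=
      fun n1 n2 h => (Prod.ext_iff.1 h).1
    refine (hg.summable_iff ?_).1 ?_
    · intro q hq
      rw [if_neg]
      intro hq2
      exact hq ⟨q.1, Prod.ext rfl hq2.symm⟩
    · have hc : ((fun q : ℕ × ℤ => if q.2 = j then |V (z (j + q.1) - z j).natAbs| else 0) ∘
          fun n : ℕ => ((n, j) : ℕ × ℤ)) =
          (fun n => |V n|) ∘ fun n : ℕ => (z (j + n) - z j).natAbs := by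
        funext n
        simp
      rw [hc]
      refine hVa.comp_injective fun n1 n2 h => ?_
      have h1 := hz.monotone (show j ≤ j + n1 by omega)
      have h2 := hz.monotone (show j ≤ j + n2 by omega)
      have h3 : z (j + n1) = z (j + n2) := by omega
      have h4 := hz.injective h3
      omega
  have hB2 : ∀ j : ℤ, Summable (fun q : ℕ × ℤ =>
      if q.2 = j - q.1 then |V (z j - z (j - q.1)).natAbs| else 0) := by
    intro j
    have hg : Function.Injective (fun n : ℕ => ((n, j - n) : ℕ × ℤ)) :=
      fun n1 n2 h => (Prod.ext_iff.1 h).1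
    refine (hg.summable_iff ?_).1 ?_
    · intro q hq
      rw [if_neg]
      intro hq2
      exact hq ⟨q.1, Prod.ext rfl hq2.symm⟩
    · have hc : ((fun q : ℕ × ℤ => if q.2 = j - q.1 then |V (z j - z (j - q.1)).natAbs| else 0) ∘
          fun n : ℕ => ((n, j - n) : ℕ × ℤ)) =
          (fun n => |V n|) ∘ fun n : ℕ => (z j - z (j - n)).natAbs := by
        funext n
        simp
      rw [hc]
      refine hVa.comp_injective fun n1 n2 h => ?_
      have h1 := hz.monotone (show j - n1 ≤ j by omega)
      have h2 := hz.monotone (show j - n2 ≤ j by omega)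
      have h3 : z (j - n1) = z (j - n2) := by omega
      have h4 := hz.injective h3
      omega
  have hS : Summable fun q : ℕ × ℤ =>
      (∑ j ∈ Finset.Icc a b, (if q.2 = j then |V (z (j + q.1) - z j).natAbs| else 0)) +
        ∑ j ∈ Finset.Icc a b, (if q.2 = j - q.1 then |V (z j - z (j - q.1)).natAbs| else 0) :=
    (summable_sum fun j _ => hB1 j).add (summable_sum fun j _ => hB2 j)
  refine Summable.of_nonneg_of_le (fun q => ?_) (fun q => ?_) hS
  · split_ifs with h
    · have := hz (show q.2 < q.2 + q.1 by omega)
      exact (hVpos _ (by omega)).le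
    · exact le_rfl
  · have hn1 : ∀ j ∈ Finset.Icc a b,
        0 ≤ (if q.2 = j then |V (z (j + q.1) - z j).natAbs| else 0) :=
      fun j _ => by split_ifs <;> simp [abs_nonneg]
    have hn2 : ∀ j ∈ Finset.Icc a b,
        0 ≤ (if q.2 = j - q.1 then |V (z j - z (j - q.1)).natAbs| else 0) :=
      fun j _ => by split_ifs <;> simp [abs_nonneg]
    split_ifs with h
    · rcases h with ⟨hn, hw | hw⟩
      · have h1 := Finset.single_le_sum hn1 (Finset.mem_Icc.2 hw)
        simp only [if_true] at h1
        have h2 := Finset.sum_nonneg hn2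
        have h3 := le_abs_self (V (z (q.2 + q.1) - z q.2).natAbs)
        linarith
      · have h1 := Finset.single_le_sum hn2 (Finset.mem_Icc.2 hw)
        simp only [add_sub_cancel_right, if_true] at h1
        have h2 := Finset.sum_nonneg hn1
        have h3 := le_abs_self (V (z (q.2 + q.1) - z q.2).natAbs)
        linarith
    · exact add_nonneg (Finset.sum_nonneg hn1) (Finset.sum_nonneg hn2)

/-- **Re-indexing the windowed pair energies by neighbour order.** For a configuration `Z`
occupied exactly on the range of the strictly increasing `z`, whose particles in the site window
`[m, M]` are exactly those with index in `[a, b]`, the pair energies of `Z` over the ordered pairs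
of sites meeting `[m, M]` have sum `∑_{n ≥ 1} ∑_{[i, i+n] ∩ [a, b] ≠ ∅} V(z(i+n) - z(i))`.
[folklore] -/
theorem hasSum_pairs {V : ℕ → ℝ} (hVs : Summable V) (hVpos : ∀ n, 1 ≤ n → 0 < V n)
    {z : ℤ → ℤ} (hz : StrictMono z) {Z : ℤ → Bool} (hZ : ∀ j, Z j = true ↔ j ∈ Set.range z)
    {a b m M : ℤ} (hw : ∀ i, m ≤ z i ∧ z i ≤ M ↔ a ≤ i ∧ i ≤ b) :
    HasSum (fun p : ℤ × ℤ => if p.1 < p.2 ∧ ((m ≤ p.1 ∧ p.1 ≤ M) ∨ (m ≤ p.2 ∧ p.2 ≤ M))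
        then pairEnergy V Z p.1 p.2 else 0)
      (∑' q : ℕ × ℤ, (if 1 ≤ q.1 ∧ ((a ≤ q.2 ∧ q.2 ≤ b) ∨ (a ≤ q.2 + q.1 ∧ q.2 + q.1 ≤ b))
        then V (z (q.2 + q.1) - z q.2).natAbs else 0)) := by
  have hsE := summable_window hVs hz hVpos a b
  set E : ℕ × ℤ → ℝ := fun q => if 1 ≤ q.1 ∧ ((a ≤ q.2 ∧ q.2 ≤ b) ∨ (a ≤ q.2 + q.1 ∧ q.2 + q.1 ≤ b))
      then V (z (q.2 + q.1) - z q.2).natAbs else 0 with hE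
  set D : ℤ × ℤ → ℝ := fun p => if p.1 < p.2 ∧ ((m ≤ p.1 ∧ p.1 ≤ M) ∨ (m ≤ p.2 ∧ p.2 ≤ M))
      then pairEnergy V Z p.1 p.2 else 0 with hD
  set g : ℕ × ℤ → ℤ × ℤ := fun q => (z q.2, z (q.2 + q.1)) with hg
  have hginj : Function.Injective g := by
    intro q1 q2 h
    simp only [hg, Prod.mk.injEq] at h
    have h1 := hz.injective h.1
    have h2 := hz.injective h.2
    refine Prod.ext ?_ ?_ <;> omega
  have hZz : ∀ i, Z (z i) = true := fun i => (hZ _).2 ⟨i, rfl⟩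
  have hcomp : D ∘ g = E := by
    funext q
    have hiff : (z q.2 < z (q.2 + q.1) ∧ ((m ≤ z q.2 ∧ z q.2 ≤ M) ∨
        (m ≤ z (q.2 + q.1) ∧ z (q.2 + q.1) ≤ M))) ↔
        (1 ≤ q.1 ∧ ((a ≤ q.2 ∧ q.2 ≤ b) ∨ (a ≤ q.2 + q.1 ∧ q.2 + q.1 ≤ b))) := by
      rw [hz.lt_iff_lt, hw, hw]
      constructor <;> rintro ⟨h1, h2⟩ <;> exact ⟨by omega, h2⟩
    simp only [Function.comp_apply, hD, hE, hg]
    by_cases hc : 1 ≤ q.1 ∧ ((a ≤ q.2 ∧ q.2 ≤ b) ∨ (a ≤ q.2 + q.1 ∧ q.2 + q.1 ≤ b))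
    · rw [if_pos (hiff.2 hc), if_pos hc]
      simp [pairEnergy, hZz]
    · rw [if_neg (fun h => hc (hiff.1 h)), if_neg hc]
  have hsupp : ∀ p ∉ Set.range g, D p = 0 := by
    intro p hp
    simp only [hD]
    split_ifs with h
    · unfold pairEnergy
      split_ifs with h'
      · exfalso
        apply hp
        obtain ⟨i, hi⟩ := (hZ _).1 h'.1
        obtain ⟨j, hj⟩ := (hZ _).1 h'.2
        have hij : i < j := hz.lt_iff_lt.1 (by rw [hi, hj]; exact h.1)
        refine ⟨((j - i).toNat, i), ?_⟩
        have hji : i + ((j - i).toNat : ℤ) = j := by omega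
        simp only [hg, hji, hi, hj]
      · rfl
    · rfl
  have h1 : HasSum (D ∘ g) (∑' q, E q) := by
    rw [hcomp]
    exact hsE.hasSum
  exact (hginj.hasSum_iff hsupp).1 h1

/-- DISCHARGE of the named fact `Hubbard1978_mostHomogeneous` — **Hubbard 1978 /
Pokrovsky–Uimin 1978, Theorem 0 of Jędrzejewski–Miękisz (direction "most homogeneous ⇒ ground
state")**: for every interaction of Hubbard's class `V₁` (summable, positive and strictly convex
from distance `1` on), every most homogeneous configuration is a ground-state configuration in the
canonical ensemble. Proof (Hubbard's argument, [cite: JedrzejewskiMiekisz2000, §3 (p. 8): "the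
argument of Hubbard … based on a version of our Lemma A1"]): re-enumerate the excitation `Y` by a
strictly increasing `y` agreeing with `x` outside a finite index window (`exists_enumeration`);
the relative Hamiltonian is the absolutely convergent sum, over the neighbour order `n ≥ 1`, of
the finite sums `∑_i (V(y(i+n) - y(i)) - V(x(i+n) - x(i)))` over the index pairs meeting the
window (`hasSum_pairs`, `HasSum.prod_fiberwise`); for each `n` the two families of gaps have the
same total, the `x`-gaps take only the values `d_n`, `d_n + 1`, so by convexity (the supporting
line at `d_n`, Lemma A1) each finite sum is `≥ 0` (`sum_le_sum_of_convex`).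
[cite: JedrzejewskiMiekisz2000, §2 Theorem 0 (p. 6), §3 (p. 8), Appendix Lemma A1 (p. 18)] -/
theorem Hubbard1978_mostHomogeneous_holds : Hubbard1978_mostHomogeneous := by
  intro V hV x hxmh Λ Y hY hcard
  classical
  obtain ⟨hVs, hVpos, hVconv⟩ := hV
  have hx : StrictMono x := hxmh.1
  obtain ⟨y, a, b, m, M, hy, hYr, hxy, hwx, hwy, hΛ⟩ := exists_enumeration hx Λ hY hcard
  have hXr : ∀ j, configOf x j = true ↔ j ∈ Set.range x := configOf_eq_true_iff x
  have hsY := summable_window hVs hy hVpos a b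
  have hsX := summable_window hVs hx hVpos a b
  have hDY := hasSum_pairs hVs hVpos hy hYr hwy
  have hDX := hasSum_pairs hVs hVpos hx hXr hwx
  set EY : ℕ × ℤ → ℝ := fun q =>
    if 1 ≤ q.1 ∧ ((a ≤ q.2 ∧ q.2 ≤ b) ∨ (a ≤ q.2 + q.1 ∧ q.2 + q.1 ≤ b))
      then V (y (q.2 + q.1) - y q.2).natAbs else 0 with hEY
  set EX : ℕ × ℤ → ℝ := fun q =>
    if 1 ≤ q.1 ∧ ((a ≤ q.2 ∧ q.2 ≤ b) ∨ (a ≤ q.2 + q.1 ∧ q.2 + q.1 ≤ b))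
      then V (x (q.2 + q.1) - x q.2).natAbs else 0 with hEX
  -- the relative Hamiltonian as the difference of the two windowed energy sums
  set D : ℤ × ℤ → ℝ := fun p =>
    if p.1 < p.2 then pairEnergy V Y p.1 p.2 - pairEnergy V (configOf x) p.1 p.2 else 0 with hD
  have hDsum : HasSum D ((∑' q, EY q) - ∑' q, EX q) := by
    refine (hDY.sub hDX).congr_fun fun p => ?_
    simp only [hD]
    by_cases h1 : p.1 < p.2
    · by_cases h2 : (m ≤ p.1 ∧ p.1 ≤ M) ∨ (m ≤ p.2 ∧ p.2 ≤ M)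
      · simp [h1, h2]
      · have hp1 : p.1 ∉ Λ := fun h => h2 (Or.inl (hΛ _ h))
        have hp2 : p.2 ∉ Λ := fun h => h2 (Or.inr (hΛ _ h))
        simp [h1, h2, pairEnergy, hY _ hp1, hY _ hp2]
    · simp [h1]
  have hrel : relHamiltonian V Λ Y (configOf x) = (∑' q, EY q) - ∑' q, EX q := by
    have hval : ∀ p ∉ Set.range
        (Subtype.val : {p : ℤ × ℤ // p.1 < p.2 ∧ (p.1 ∈ Λ ∨ p.2 ∈ Λ)} → ℤ × ℤ), D p = 0 := by
      intro p hp
      simp only [hD]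
      split_ifs with h1
      · have hnot : ¬(p.1 ∈ Λ ∨ p.2 ∈ Λ) := fun h => hp ⟨⟨p, h1, h⟩, rfl⟩
        have hp1 : p.1 ∉ Λ := fun h => hnot (Or.inl h)
        have hp2 : p.2 ∉ Λ := fun h => hnot (Or.inr h)
        simp [pairEnergy, hY _ hp1, hY _ hp2]
      · rfl
    have h2 := (Subtype.val_injective.hasSum_iff hval).2 hDsum
    rw [← h2.tsum_eq]
    unfold relHamiltonian
    exact tsum_congr fun p => by simp [hD, p.2.1]
  rw [hrel]
  -- fibrewise: for each neighbour order `n`, a finite sum which convexity makes nonnegative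
  have hG : HasSum (fun q => EY q - EX q) ((∑' q, EY q) - ∑' q, EX q) :=
    hsY.hasSum.sub hsX.hasSum
  refine HasSum.nonneg (g := fun n : ℕ => ∑ i ∈ Finset.Icc (a - n) b, (EY (n, i) - EX (n, i)))
    (fun n => ?_) (hG.prod_fiberwise fun n => hasSum_sum_of_ne_finset_zero fun i hi => ?_)
  · show 0 ≤ ∑ i ∈ Finset.Icc (a - n) b, (EY (n, i) - EX (n, i))
    rcases Nat.lt_or_ge n 1 with hn | hn
    · refine Finset.sum_nonneg fun i _ => ?_
      have hc : ¬(1 ≤ n ∧ ((a ≤ i ∧ i ≤ b) ∨ (a ≤ i + n ∧ i + n ≤ b))) := by omega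
      simp only [hEY, hEX, if_neg hc, sub_self]
      exact le_rfl
    · replace hn : 1 ≤ n := hn
      have hterm : ∀ i ∈ Finset.Icc (a - n) b, EY (n, i) - EX (n, i) =
          V (y (i + n) - y i).natAbs - V (x (i + n) - x i).natAbs := by
        intro i hi
        simp only [Finset.mem_Icc] at hi
        by_cases hc : (a ≤ i ∧ i ≤ b) ∨ (a ≤ i + n ∧ i + n ≤ b)
        · simp only [hEY, hEX, if_pos (And.intro hn hc)]
        · have hc' : ¬(1 ≤ n ∧ ((a ≤ i ∧ i ≤ b) ∨ (a ≤ i + n ∧ i + n ≤ b))) := fun h => hc h.2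
          have hi1 : i < a ∨ b < i := by omega
          have hi2 : i + n < a ∨ b < i + n := by omega
          simp only [hEY, hEX, if_neg hc', hxy _ hi1, hxy _ hi2, sub_self]
      rw [Finset.sum_congr rfl hterm, Finset.sum_sub_distrib, sub_nonneg]
      obtain ⟨d, hd⟩ := hxmh.2 n hn
      have hgap : ∀ i, (n : ℤ) ≤ x (i + n) - x i := fun i => by
        have := add_le_of_strictMono hx i n; omega
      have hgapy : ∀ i, (n : ℤ) ≤ y (i + n) - y i := fun i => by
        have := add_le_of_strictMono hy i n; omega
      obtain ⟨d', hd'1, hd'⟩ : ∃ d' : ℕ, 1 ≤ d' ∧ ∀ i,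
          (x (i + n) - x i).natAbs = d' ∨ (x (i + n) - x i).natAbs = d' + 1 := by
        rcases le_or_gt 1 d with h1 | h1
        · refine ⟨d.toNat, by omega, fun i => ?_⟩
          rcases hd i with h | h
          · left; omega
          · right; omega
        · refine ⟨(d + 1).toNat, ?_, fun i => Or.inl ?_⟩
          · have := hd 0
            have := hgap 0
            omega
          · have := hd i
            have := hgap i
            omega
      refine sum_le_sum_of_convex (Finset.Icc (a - n) b) (fun k hk => (hVconv k hk).le) hd'1
        (fun i _ => hd' i) (fun i _ => by have := hgapy i; omega) ?_
      have e1 : ∀ i, (((y (i + n) - y i).natAbs : ℕ) : ℤ) = y (i + n) - y i := fun i => by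
        have := hgapy i; omega
      have e2 : ∀ i, (((x (i + n) - x i).natAbs : ℕ) : ℤ) = x (i + n) - x i := fun i => by
        have := hgap i; omega
      simp only [e1, e2]
      exact sum_gaps_eq hxy n
  · simp only [Finset.mem_Icc, not_and_or, not_le] at hi
    have hc : ¬(1 ≤ n ∧ ((a ≤ i ∧ i ≤ b) ∨ (a ≤ i + n ∧ i + n ≤ b))) := by omega
    simp only [hEY, hEX, if_neg hc, sub_self]

end Literature.Barriers.AtomisticToContinuum.HubbardChain

end
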